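import Summits.QuantumFields.YangMills.Theses.LangevinControlUV
import Summits.QuantumFields.YangMills.Theorems.HypercubicLimit.Negative.AllTimesGapFalse

/-!
# `LatticeGapInUVUnits` — negative-side support: the time bound `n ≤ S` of the conclusion is load-bearing

Support file for crux `stmt-QuantumFields-9366` (`LangevinControlUV.LatticeGapInUVUnits`, route `LangevinControlUV`,
rank 5), from the standing disprover's work file `Cruxes/LatticeGapInUVUnits/Disproof.lean` (§12, gen 3). Tree objects
only; nothing is posited and no definition is introduced.

The conclusion of the crux reads `∃ c₁ > 0, β₂, S₁, ∀ A B, ∃ C, ∀ β ≥ β₂, ∀ S ≥ S₁ β, ∀ n ≤ S,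
|corr_{β,2S+1}(A, B, n)| ≤ C e^{−c₁ a(β) n}` (`latticeConnectedCorr` on the periodic torus of side `2S+1`). The natural
strengthening in which the time separation `n` is UNRESTRICTED (drop `n ≤ S`) is FALSE for every non-abelian compact
gauge group, every faithful `r` and EVERY unit map `a > 0` — whatever the hypotheses of the crux:

* `not_allTimes_clustering`: torus time-correlations are periodic with period the side (tree
  `latticeConnectedCorr_add_mul_side`), so along `n = m (2S+1) → ∞` the bound forces the variance (`n = 0`, tree
  `latticeConnectedCorr_zero_time`) of the curvature observable to vanish, against `variance_pos` / `actionDensity_ne`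
  (Wilson's measure charges open sets; `tr F²` separates `1` from an `ab ≠ ba` configuration);
* `not_allTimes_clustering_of_simple`: in particular for every compact simple Lie group;
* `latticeGapInUVUnits_allTimes_iff_no_package`: consequently the all-times variant of the crux is EQUIVALENT to the
  assertion that NO compact simple `G`, `r`, `a` carries the femto two-point package at all (the hypothesis of the crux,
  = the body of `FemtoCurvatureTwoPoint` at `a`) — a statement about the package alone, in which the mass gap has
  disappeared. So `n ≤ S` (the short way round the torus) is exactly what gives the conclusion content; compare the tree's
  `HypercubicLimit.Negative.not_hasLatticeMassGapAllTimes` for the scheme-indexed `HasLatticeMassGap`. [folklore]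
-/

namespace Summit.QuantumFields.YangMills.Theorems.LatticeGapInUVUnits.Negative

open Filter Topology MeasureTheory
open Literature.MathematicalPhysics.QuantumFieldTheory Literature.MathematicalPhysics.QuantumLattice
open Summit.QuantumFields.YangMills.Theorems.HypercubicLimit.Negative
  (variance_pos actionDensity_ne torusLift_dirConfigT torusLift_one latticeConnectedCorr_zero_time
    latticeConnectedCorr_add_mul_side)

noncomputable section

variable {G : Type} [Group G] [TopologicalSpace G] [IsTopologicalGroup G] [CompactSpace G]
  [MeasurableSpace G] [BorelSpace G]

/-- **The all-times strengthening of the crux's conclusion is FALSE for every non-abelian compact `G`**, every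
faithful `r` and every unit map `a > 0` (indeed for every rate `c₁ > 0`, threshold `β₂` and volume function `S₁`):
on the torus of side `2S+1`, `S = S₁ β₂`, the correlation at time `m (2S+1)` IS the variance of the curvature
observable (periodicity), which is positive, while the bound `C e^{−c₁ a(β₂) m (2S+1)}` tends to `0`. [folklore] -/
theorem not_allTimes_clustering (hG : ∃ g h : G, g * h ≠ h * g) (r : LatticeRep G) {a : ℝ → ℝ}
    (ha : ∀ β, 0 < a β) :
    ¬ ∃ (c₁ β₂ : ℝ) (S₁ : ℝ → ℕ), 0 < c₁ ∧ ∀ A B : YMSpecies G, ∃ C : ℝ, ∀ β : ℝ, β₂ ≤ β → ∀ S n : ℕ,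
      S₁ β ≤ S →
        |latticeConnectedCorr r.ρ β (2 * S + 1) A.F B.F n| ≤ C * Real.exp (-(c₁ * a β * n)) := by
  rintro ⟨c₁, β₂, S₁, hc₁, h⟩
  obtain ⟨g₁, g₂, hg⟩ := hG
  obtain ⟨C, hC⟩ := h r.curvature r.curvature
  set S := S₁ β₂ with hS
  -- the bound along the periodic copies `m (2S+1)` of the time `0` tends to `0`
  have hrate : 0 < c₁ * a β₂ * ((2 * S + 1 : ℕ) : ℝ) := mul_pos (mul_pos hc₁ (ha β₂)) (by positivity)
  have hlim : Tendsto (fun m : ℕ => C * Real.exp (-(c₁ * a β₂ * ((0 + m * (2 * S + 1) : ℕ) : ℝ))))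
      atTop (𝓝 0) := by
    have h1 : Tendsto (fun m : ℕ => c₁ * a β₂ * ((0 + m * (2 * S + 1) : ℕ) : ℝ)) atTop atTop := by
      have : (fun m : ℕ => c₁ * a β₂ * ((0 + m * (2 * S + 1) : ℕ) : ℝ)) =
          fun m : ℕ => c₁ * a β₂ * ((2 * S + 1 : ℕ) : ℝ) * (m : ℝ) := by
        funext m; push_cast; ring
      rw [this]
      exact Tendsto.const_mul_atTop hrate tendsto_natCast_atTop_atTop
    have hexp := Real.tendsto_exp_atBot.comp (tendsto_neg_atTop_atBot.comp h1)
    simpa using hexp.const_mul C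
  have hbound : ∀ m : ℕ, |latticeConnectedCorr r.ρ β₂ (2 * S + 1) r.curvature.F r.curvature.F 0| ≤
      C * Real.exp (-(c₁ * a β₂ * ((0 + m * (2 * S + 1) : ℕ) : ℝ))) := fun m => by
    rw [← latticeConnectedCorr_add_mul_side r.ρ β₂ (2 * S + 1) r.curvature.F r.curvature.F 0 m]
    exact hC β₂ le_rfl S _ le_rfl
  have h0 : |latticeConnectedCorr r.ρ β₂ (2 * S + 1) r.curvature.F r.curvature.F 0| ≤ 0 :=
    ge_of_tendsto' hlim hbound
  have hzero : latticeConnectedCorr r.ρ β₂ (2 * S + 1) r.curvature.F r.curvature.F 0 = 0 :=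
    abs_eq_zero.1 (le_antisymm h0 (abs_nonneg _))
  -- but it is the variance of the curvature observable, which is positive
  rw [latticeConnectedCorr_zero_time] at hzero
  have hP : Continuous fun W : GaugeConfig 4 (2 * S + 1) G => r.curvature.F (torusLift (2 * S + 1) W) :=
    (continuous_actionDensity r.continuous).comp (continuous_pi fun _ => continuous_apply _)
  have hne : r.curvature.F (torusLift (2 * S + 1)
      (fun e : Edge 4 (2 * S + 1) => if e.2 = 0 then g₁ else if e.2 = 1 then g₂ else (1 : G))) ≠
      r.curvature.F (torusLift (2 * S + 1) (fun _ => 1)) := by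
    rw [torusLift_dirConfigT, torusLift_one]
    exact actionDensity_ne r hg
  have hvar := variance_pos r β₂ (2 * S + 1) hP hne
  linarith

/-- Specialisation to compact simple `G` (non-abelian by definition of `IsSimpleCompactGroup`). [folklore] -/
theorem not_allTimes_clustering_of_simple (hG : IsCompactSimpleLieGroup G) (r : LatticeRep G) {a : ℝ → ℝ}
    (ha : ∀ β, 0 < a β) :
    ¬ ∃ (c₁ β₂ : ℝ) (S₁ : ℝ → ℕ), 0 < c₁ ∧ ∀ A B : YMSpecies G, ∃ C : ℝ, ∀ β : ℝ, β₂ ≤ β → ∀ S n : ℕ,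
      S₁ β ≤ S →
        |latticeConnectedCorr r.ρ β (2 * S + 1) A.F B.F n| ≤ C * Real.exp (-(c₁ * a β * n)) :=
  not_allTimes_clustering hG.1.2.1 r ha

end

end Summit.QuantumFields.YangMills.Theorems.LatticeGapInUVUnits.Negative

/-- **The all-times variant of the crux says nothing about a gap: it is EQUIVALENT to the universal
unsatisfiability of the femto two-point package.** Replace `n ≤ S →` by nothing in the conclusion of
`LatticeGapInUVUnits` (hypothesis verbatim): the resulting statement holds iff NO compact simple `G`, faithful `r`
and unit map `a` carries the package (the hypothesis contains `∀ β, 0 < a β`, so `not_allTimes_clustering_of_simple`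
applies). The time bound is therefore the clause that makes the crux a mass-gap statement rather than a disguised
negation of `FemtoCurvatureTwoPoint`-type bounds. [folklore] -/
theorem Summit.QuantumFields.YangMills.Theorems.LatticeGapInUVUnits.Negative.latticeGapInUVUnits_allTimes_iff_no_package :
    (open Literature.MathematicalPhysics.QuantumFieldTheory in ∀ (G : Type) [Group G] [TopologicalSpace G] [IsTopologicalGroup G] [CompactSpace G], IsCompactSimpleLieGroup G → letI : MeasurableSpace G := borel G; haveI : BorelSpace G := ⟨rfl⟩; ∀ (r : LatticeRep G), ∀ (a : ℝ → ℝ), (∃ (Γ : ℝ → ℝ) (β₀ ℓ₀ c C : ℝ), 0 < ℓ₀ ∧ 0 < c ∧ (∀ β, 0 < a β) ∧ Filter.Tendsto a Filter.atTop (nhds 0) ∧ (∀ s : ℝ, 0 < s → s ≤ ℓ₀ → 0 < Γ s ∧ Γ s ≤ 1) ∧ ∀ (L : ℕ) [NeZero L] (β : ℝ), β₀ ≤ β → (L : ℝ) * a β ≤ ℓ₀ → let P : (Fin 4 → ZMod L) → Fin 4 → Fin 4 → GaugeConfig 4 L G → ℝ := fun x i j U => (r.N : ℝ) - (r.ρ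 (plaquetteHolonomy U x i j)).trace.re; let E : (GaugeConfig 4 L G → ℝ) → ℝ := fun F => wilsonExpectation (d := 4) (L := L) r.ρ β F; let cov : (GaugeConfig 4 L G → ℝ) → (GaugeConfig 4 L G → ℝ) → ℝ := fun F F' => E (fun U => F U * F' U) - E F * E F'; let dist : (Fin 4 → ZMod L) → (Fin 4 → ZMod L) → ℝ := fun x y => Real.sqrt (∑ k : Fin 4, (((x k - y k).valMinAbs : ℤ) : ℝ) ^ 2); (∀ n : ℕ, 1 ≤ n → 8 * n ≤ L → c * Γ ((n : ℝ) * a β) ≤ (n : ℝ) ^ 8 * cov (P 0 0 1) (P (Pi.single (2 : Fin 4) ((n : ℕ) : ZMod L)) 0 1) ∧ (n : ℝ) ^ 8 * cov (P 0 0 1) (P (Pi.single (2 : Fin 4) ((n : ℕ) : ZMod L)) 0 1) ≤ C * Γ ((n : ℝ) * a β)) ∧ (∀ (x y : Fin 4 → ZMod L) (i j i' j' : Fin 4), x ≠ y → i ≠ j → i' ≠ j' → |cov (P x i j) (P y i' j')| * dist x y ^ 8 ≤ C * Γ (dist x y * a β))) → ∃ (c₁ β₂ : ℝ) (S₁ :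 ℝ → ℕ), 0 < c₁ ∧ ∀ A B : YMSpecies G, ∃ C : ℝ, ∀ β : ℝ, β₂ ≤ β → ∀ S n : ℕ, S₁ β ≤ S → |latticeConnectedCorr r.ρ β (2 * S + 1) A.F B.F n| ≤ C * Real.exp (-(c₁ * a β * n))) ↔
    (open Literature.MathematicalPhysics.QuantumFieldTheory in ∀ (G : Type) [Group G] [TopologicalSpace G] [IsTopologicalGroup G] [CompactSpace G], IsCompactSimpleLieGroup G → letI : MeasurableSpace G := borel G; haveI : BorelSpace G := ⟨rfl⟩; ∀ (r : LatticeRep G), ∀ (a : ℝ → ℝ), ¬ (∃ (Γ : ℝ → ℝ) (β₀ ℓ₀ c C : ℝ), 0 < ℓ₀ ∧ 0 < c ∧ (∀ β, 0 < a β) ∧ Filter.Tendsto a Filter.atTop (nhds 0) ∧ (∀ s : ℝ, 0 < s → s ≤ ℓ₀ → 0 < Γ s ∧ Γ s ≤ 1) ∧ ∀ (L : ℕ) [NeZero L] (β : ℝ), β₀ ≤ β → (L : ℝ) * a β ≤ ℓ₀ → let P : (Fin 4 → ZMod L) → Fin 4 → Fin 4 → GaugeConfig 4 L G → ℝ :=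 fun x i j U => (r.N : ℝ) - (r.ρ (plaquetteHolonomy U x i j)).trace.re; let E : (GaugeConfig 4 L G → ℝ) → ℝ := fun F => wilsonExpectation (d := 4) (L := L) r.ρ β F; let cov : (GaugeConfig 4 L G → ℝ) → (GaugeConfig 4 L G → ℝ) → ℝ := fun F F' => E (fun U => F U * F' U) - E F * E F'; let dist : (Fin 4 → ZMod L) → (Fin 4 → ZMod L) → ℝ := fun x y => Real.sqrt (∑ k : Fin 4, (((x k - y k).valMinAbs : ℤ) : ℝ) ^ 2); (∀ n : ℕ, 1 ≤ n → 8 * n ≤ L → c * Γ ((n : ℝ) * a β) ≤ (n : ℝ) ^ 8 * cov (P 0 0 1) (P (Pi.single (2 : Fin 4) ((n : ℕ) : ZMod L)) 0 1) ∧ (n : ℝ) ^ 8 * cov (P 0 0 1) (P (Pi.single (2 : Fin 4) ((n : ℕ) : ZMod L)) 0 1) ≤ C * Γ ((n : ℝ) * a β)) ∧ (∀ (x y : Fin 4 → ZMod L) (i j i' j' : Fin 4), x ≠ y → i ≠ j → i' ≠ j' → |cov (P x i j) (P y i' j')| * dist x y ^ 8 ≤ C * Γ (dist x y * a β)))) :=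 by
  constructor
  · intro h G _ _ _ _ hG r a hP
    letI : MeasurableSpace G := borel G
    haveI : BorelSpace G := ⟨rfl⟩
    have ha : ∀ β, 0 < a β := by
      obtain ⟨Γ, β₀, ℓ₀, c, C, -, -, ha, -⟩ := hP
      exact ha
    exact Summit.QuantumFields.YangMills.Theorems.LatticeGapInUVUnits.Negative.not_allTimes_clustering_of_simple
      hG r ha (h G hG r a hP)
  · intro h G _ _ _ _ hG r a hP
    exact absurd hP (h G hG r a)
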